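import Literature.NumberTheory.Transcendental.RoySmallValueEstimatesConjClassProofs
import Literature.NumberTheory.Transcendental.RoySmallValueEstimatesTauFixedPointsProofs
import HarnessLib

/-!
# Small value estimates at rational translates (Nguyen–Roy 2016) — proofs, XXII: Proposition 14 from the arithmetic Bézout bound

Twenty-second proofs file towards `Literature.NumberTheory.Transcendental.nguyenRoy2016_thm_1` (Nguyen–Roy,
IJNT 12 (2016) = arXiv:1412.5163). Everything here is PROVED; no named facts.

> **Proposition 14.** Let `D ≥ D₀` and `T = ⌊D^σ⌋`. If `W_D ≠ ∅`, any `ℚ`-subvariety `Z` of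
> `ℙ²(ℂ)` contained in `W_D` has dimension `0` and, if `D` is large enough, it satisfies
> `deg(τⁱ(Z)) ≤ 2D^{2−σ}` and `h(τⁱ(Z)) ≤ 6D^{1+β−σ}` (`|i| < 3T`).

The printed proof has an ARITHMETIC part — with `P = P̃_D` and `Q = ∑ aᵢ Φⁱ(P)` coprime to `P`
(Lemma 13; tree `RoySmallValueEstimatesTranslatesGcdProofs`), `W = 𝒵(P, Q)` is finite with
`deg(W) ≤ D²` and `h(W) ≤ D log ‖P‖ + D log ‖Q‖ + O(D²) ≤ 5D^{1+β}` — and a COMBINATORIAL part: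
`τⁱ(Z) ⊆ W` for `0 ≤ i < T`, these translates are distinct unless `Z` is one of the two fixed
points (tree `RoySmallValueEstimatesTauFixedPointsProofs`), so `T deg Z ≤ deg W`,
`∑ h(τⁱZ) ≤ h(W)`, and Lemma 11 finishes. This file proves the combinatorial part in the concrete
terms of the instantiation (`V = AlgPt`, `pts = conj`, `ht = deg · h_abs`, `IsIn`), taking the
arithmetic part as the input `ZeroBounds` ("the common zeros of `P̃_D` and
`Q_{D,t} = ∑_{i=1}^D tⁱ Φⁱ P̃_D` lie in a finite set of at most `D²` points whose absolute heights
sum to at most `B_z D^{1+β}`", for some `t`):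

* `Qcomb`, `ZeroBounds`;
* `eval_nv_tauA_eq_zero_iff` (a form vanishes at `τⁱq` iff its `Φⁱ`-translate vanishes at `q`),
  `vanish_at_conj_tauA` (`τⁱ(Z) ⊆ W` for `Z ⊆ W_D`, `0 ≤ i`, `i + D < 2T`);
* `habs_e010`, `habs_e001` (the fixed points have height `0`), `conj_tauA_ne` (distinct translates
  of a class avoiding the fixed points, from the tree's `image_tauP_injective`);
* **`prop14_of_zeroBounds`** — the `prop14` field of `WallData` with `A₁₄ = 2`,
  `B₁₄ = 2B_z + 7c₄ + 1`, from `ZeroBounds` at every level `D ≥ D₀`.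

## References

* [NguyenRoy2016] N. A. V. Nguyen, D. Roy, IJNT 12 (2016) 1273–1293 = arXiv:1412.5163, §5,
  Proposition 14 and its proof.
-/

noncomputable section

open Height Module Finset MvPolynomial
open Literature.NumberTheory.Transcendental.Nesterenko
open Literature.NumberTheory.Transcendental.Roy2013 (CX)
open scoped Classical

namespace Literature.NumberTheory.Transcendental

namespace NguyenRoy

section P14

variable (ξ η : ℂ) (r s : ℚ) (σ β ν : ℝ) (Pt : ℕ → MvPolynomial (Fin 3) ℤ)

/-- `Q_{D,t} = ∑_{i=1}^D tⁱ Φⁱ(P̃_D)` (the combination of the proof of Proposition 14, complex form).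
[cite: NguyenRoy2016, §5, proof of Proposition 14] -/
def Qcomb (D t : ℕ) : CX := ∑ i ∈ Icc 1 D, ((t : ℂ) ^ i) • Fpoly r s Pt D i

/-- **The arithmetic Bézout input** at level `D`: for some `t`, the common zeros of `P̃_D` and
`Q_{D,t}` lie in a finite set `W` with `#W ≤ D²` and `∑_{α ∈ W} h_abs(α) ≤ B_z D^{1+β}`.
Nothing is asserted: this is the hypothesis of `prop14_of_zeroBounds`.
[cite: NguyenRoy2016, §5, proof of Proposition 14 ("deg(W) ≤ D²", "h(W) ≤ 5D^{1+β}")] -/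
def ZeroBounds (Bz : ℝ) (D : ℕ) : Prop :=
  ∃ (t : ℕ) (W : Finset PPt),
    (∀ a : PPt, eval (nv a) (map (Int.castRingHom ℂ) (Pt D)) = 0 →
      eval (nv a) (Qcomb r s Pt D t) = 0 → a ∈ W) ∧
    ((W.card : ℝ) ≤ (D : ℝ) ^ 2) ∧ (∑ a ∈ W, habs a ≤ Bz * (D : ℝ) ^ (1 + β))

variable {ξ η r s σ β ν Pt}

/-! ### Forms at translated points -/

/-- `Φⁱ P̃_D` is a form of degree `D` (under `PropsAt`). [folklore] -/
theorem isHomogeneous_Fpoly {D : ℕ} (hD : PropsAt ξ η r s σ β ν Pt D) (i : ℕ) :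
    (Fpoly r s Pt D i).IsHomogeneous D :=
  Roy2013.isHomogeneous_tau _ _ (hD.1.map _)

/-- `Φⁱ(Φʲ P̃_D) = Φ^{i+j} P̃_D`. [cite: NguyenRoy2016, §2] -/
theorem tau_Fpoly (D i j : ℕ) :
    Roy2013.tau ((i : ℂ) * (r : ℂ)) ((s : ℂ) ^ i) (Fpoly r s Pt D j) = Fpoly r s Pt D (i + j) := by
  have e1 : (i : ℂ) * (r : ℂ) + (j : ℂ) * (r : ℂ) = ((i + j : ℕ) : ℂ) * (r : ℂ) := by
    push_cast; ring
  have e2 : (s : ℂ) ^ i * (s : ℂ) ^ j = (s : ℂ) ^ (i + j) := (pow_add _ _ _).symm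
  rw [Fpoly, Fpoly, Roy2013.tau_tau, e1, e2]

/-- **A form vanishes at `τⁱ q` iff its `Φⁱ`-translate vanishes at `q`** (`i ≥ 0`, `q` algebraic).
[cite: NguyenRoy2016, §5, proof of Proposition 14 ("τⁱ(Z) ⊆ W")] -/
theorem eval_nv_tauA_eq_zero_iff (hs : s ≠ 0) (Q : AlgPt) (i : ℕ) {F : CX} {D : ℕ}
    (hF : F.IsHomogeneous D) :
    eval (nv (Q.tauA r hs i).1) F = 0 ↔
      eval (nv Q.1) (Roy2013.tau ((i : ℂ) * (r : ℂ)) ((s : ℂ) ^ i) F) = 0 := by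
  obtain ⟨c, hc, hrel⟩ := Q.exists_rat_smul_nv_tauA r hs i
  have hsC : (s : ℂ) ≠ 0 := by exact_mod_cast hs
  have hM : tauMat ((i : ℂ) * (r : ℂ)) ((s : ℂ) ^ i) = tauMat (r : ℂ) (s : ℂ) ^ (i : ℤ) := by
    rw [← tauMat_int_mul_eq_zpow (r : ℂ) hsC (i : ℤ)]
    simp
  rw [eval_tau, hM, hrel, eval_smul_of_isHomogeneous hF, mul_eq_zero]
  have hcD : ((c : ℂ)) ^ D ≠ 0 := pow_ne_zero _ (by exact_mod_cast hc)
  constructor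
  · exact fun h => Or.inr h
  · rintro (h | h)
    · exact absurd h hcD
    · exact h

/-- The `Φʲ P̃_D`, `j < 2T`, vanish at every conjugate of a `Z ⊆ W_D`. [cite: NguyenRoy2016, §5] -/
theorem eval_Fpoly_eq_zero_of_isIn {D : ℕ} (hD : PropsAt ξ η r s σ β ν Pt D) {Z : AlgPt}
    (hZ : IsIn r s σ Pt Z D) {q : PPt} (hq : q ∈ Z.conj) {j : ℕ} (hj : j < 2 * ⌊(D : ℝ) ^ σ⌋₊) :
    eval (nv q) (Fpoly r s Pt D j) = 0 := by
  obtain ⟨⟨Qi, -, hQmap, -⟩, -⟩ := hD.2.2 j (by omega)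
  rw [← hQmap, Z.eval_map_eq_zero_iff_of_mem_conj Qi hq]
  exact hZ j hj Qi hQmap

/-- **`τⁱ(Z) ⊆ W` for `Z ⊆ W_D` and `0 ≤ i`, `i + D < 2T`**: `P̃_D` and `Q_{D,t}` vanish at every
conjugate of `τⁱZ`. [cite: NguyenRoy2016, §5, proof of Proposition 14 ("Since D ≤ T, we have τⁱ(Z) ⊆ W for i = 0, …, T−1")] -/
theorem vanish_at_conj_tauA (hs : s ≠ 0) {D : ℕ} (hD : PropsAt ξ η r s σ β ν Pt D) {Z : AlgPt}
    (hZ : IsIn r s σ Pt Z D) {i : ℕ} (hi : i + D < 2 * ⌊(D : ℝ) ^ σ⌋₊) (t : ℕ) {a : PPt}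
    (ha : a ∈ (Z.tauA r hs i).conj) :
    eval (nv a) (map (Int.castRingHom ℂ) (Pt D)) = 0 ∧ eval (nv a) (Qcomb r s Pt D t) = 0 := by
  rw [Z.mem_conj_tauA r hs i] at ha
  obtain ⟨q, hq, rfl⟩ := ha
  have hqa : IsAlgPt q := Z.isAlgPt_of_mem_conj hq
  have key : ∀ F : CX, F.IsHomogeneous D → (eval (nv (tauQ r hs i q)) F = 0 ↔
      eval (nv q) (Roy2013.tau ((i : ℂ) * (r : ℂ)) ((s : ℂ) ^ i) F) = 0) := fun F hF =>
    eval_nv_tauA_eq_zero_iff (r := r) hs ⟨q, hqa⟩ i hF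
  constructor
  · rw [key _ (hD.1.map _)]
    exact eval_Fpoly_eq_zero_of_isIn hD hZ hq (by omega)
  · have hQh : (Qcomb r s Pt D t).IsHomogeneous D := by
      unfold Qcomb
      refine MvPolynomial.IsHomogeneous.sum _ _ _ fun j _ => ?_
      rw [smul_eq_C_mul]
      exact (isHomogeneous_Fpoly hD j).C_mul _
    rw [key _ hQh, Qcomb, map_sum, map_sum]
    refine Finset.sum_eq_zero fun j hj => ?_
    rw [map_smul, tau_Fpoly, smul_eq_C_mul, map_mul, eval_C,
      eval_Fpoly_eq_zero_of_isIn hD hZ hq (by have := (mem_Icc.mp hj).2; omega), mul_zero]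

/-! ### The two fixed points -/

/-- `(0:1:0)`. [cite: NguyenRoy2016, §5, proof of Proposition 14] -/
def e010 : PPt := Projectivization.mk ℂ ![0, 1, 0] e010_ne_zero

/-- `(0:0:1)`. [cite: NguyenRoy2016, §5, proof of Proposition 14] -/
def e001 : PPt := Projectivization.mk ℂ ![0, 0, 1] e001_ne_zero

/-- A point with integer coordinates in `{0, 1}` has absolute height `0`. [folklore] -/
theorem habs_mk_ratCast_eq_zero (z : Fin 3 → ℤ) (hz : ∀ j, z j = 0 ∨ z j = 1)
    (hne : (fun j => ((z j : ℚ) : ℂ)) ≠ 0) :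
    habs (Projectivization.mk ℂ (fun j => ((z j : ℚ) : ℂ)) hne) = 0 := by
  have h := habs_mk (K := ℚ) (Rat.castHom ℂ) (fun j => (z j : ℚ)) hne
  simp only [Rat.coe_castHom] at h
  rw [h]
  have hle : logHeight (fun j => (z j : ℚ)) ≤ 0 := by
    have := logHeight_intCast_le (K := ℚ) z le_rfl (B := 1) fun j => by
      rcases hz j with h0 | h1
      · rw [h0]; simp
      · rw [h1]; simp
    simpa using this
  have hge : 0 ≤ logHeight (fun j => (z j : ℚ)) := logHeight_nonneg _
  rw [le_antisymm hle hge, zero_div]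

/-- `h_abs((0:1:0)) = 0`. [folklore] -/
theorem habs_e010 : habs e010 = 0 := by
  have hne : (fun j => (((![0, 1, 0] : Fin 3 → ℤ) j : ℚ) : ℂ)) ≠ 0 := fun h => by
    simpa using congrFun h 1
  have h := habs_mk_ratCast_eq_zero ![0, 1, 0] (fun j => by fin_cases j <;> simp) hne
  rw [← h, e010]
  exact congrArg habs (mk_congr _ _ (funext fun j => by fin_cases j <;> simp))

/-- `h_abs((0:0:1)) = 0`. [folklore] -/
theorem habs_e001 : habs e001 = 0 := by
  have hne : (fun j => (((![0, 0, 1] : Fin 3 → ℤ) j : ℚ) : ℂ)) ≠ 0 := fun h => by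
    simpa using congrFun h 2
  have h := habs_mk_ratCast_eq_zero ![0, 0, 1] (fun j => by fin_cases j <;> simp) hne
  rw [← h, e001]
  exact congrArg habs (mk_congr _ _ (funext fun j => by fin_cases j <;> simp))

/-- **The classes of a `Z ⊆ W_D` avoiding the fixed points have pairwise distinct translates.**
[cite: NguyenRoy2016, §5, proof of Proposition 14] -/
theorem conj_tauA_ne (hr : r ≠ 0) (hs : s ≠ 0) (hs1 : s ≠ 1) (hs2 : s ≠ -1) (Z : AlgPt)
    {a : PPt} (ha : a ∈ Z.conj) (ha1 : a ≠ e010) (ha2 : a ≠ e001) {i j : ℤ} (hij : i ≠ j) :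
    (Z.tauA r hs i).conj ≠ (Z.tauA r hs j).conj := by
  rw [Z.conj_tauA r hs i, Z.conj_tauA r hs j]
  intro h
  have hsC : (s : ℂ) ≠ 0 := by exact_mod_cast hs
  have hinj := image_tauP_injective (S := Z.conj) (Rat.cast_ne_zero.mpr hr) hsC
    (fun k hk => rat_cast_zpow_ne_one hs1 hs2 hk) ha ha1 ha2
  exact hij (hinj h)

/-! ### Proposition 14 from the arithmetic input -/

/-- `⌊D^σ⌋ ≥ D` for `σ ≥ 1`. [folklore] -/
theorem le_floor_rpow {σ : ℝ} (hσ1 : 1 ≤ σ) (D : ℕ) : D ≤ ⌊(D : ℝ) ^ σ⌋₊ := by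
  rcases Nat.eq_zero_or_pos D with rfl | hD
  · simp
  · refine Nat.le_floor ?_
    have h1 : (1 : ℝ) ≤ D := by exact_mod_cast hD
    calc (D : ℝ) = (D : ℝ) ^ (1 : ℝ) := (Real.rpow_one _).symm
      _ ≤ (D : ℝ) ^ σ := Real.rpow_le_rpow_of_exponent_le h1 hσ1

/-- **Proposition 14 from the arithmetic Bézout bound.** If, for every `D ≥ D₀`, the data of
Proposition 4 are available (`PropsAt`) and the common zeros of `P̃_D` and some
`Q_{D,t} = ∑_{i=1}^D tⁱ Φⁱ P̃_D` lie in a finite set of `≤ D²` points with `∑ h_abs ≤ B_z D^{1+β}`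
(`ZeroBounds`), then from some `D₁` on: for every `Z ⊆ W_D` (`IsIn`) and `|i| < 3⌊D^σ⌋`,
`deg(τⁱZ) ≤ 2D^{2−σ}` and `ht(τⁱZ) ≤ (2B_z + 7c₄ + 1) D^{1+β−σ}`.
[cite: NguyenRoy2016, Proposition 14] -/
theorem prop14_of_zeroBounds (hr : r ≠ 0) (hs : s ≠ 0) (hs1 : s ≠ 1) (hs2 : s ≠ -1)
    (hσ1 : 1 ≤ σ) (hσ2 : σ < 2) (hβ : σ + 1 < β) {Bz : ℝ} (hBz : 0 ≤ Bz) {D₀ : ℕ}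
    (hPt : ∀ D : ℕ, D₀ ≤ D → PropsAt ξ η r s σ β ν Pt D)
    (hZB : ∀ D : ℕ, D₀ ≤ D → ZeroBounds r s β Pt Bz D) :
    ∃ D₁ : ℕ, D₀ ≤ D₁ ∧ ∀ D : ℕ, D₁ ≤ D → ∀ Z : AlgPt, IsIn r s σ Pt Z D → ∀ i : ℤ,
      |(i : ℝ)| < 3 * ⌊(D : ℝ) ^ σ⌋₊ →
        (((Z.tauA r hs i).conj).card : ℝ) ≤ 2 * (D : ℝ) ^ (2 - σ) ∧
          (Z.tauA r hs i).ht ≤ (2 * Bz + 7 * AlgPt.c4 r s + 1) * (D : ℝ) ^ (1 + β - σ) := by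
  -- large `D`: `D ≥ 1` and `D^σ ≥ 2`
  have hev : ∀ᶠ D : ℕ in Filter.atTop, (2 : ℝ) ≤ (D : ℝ) ^ σ := by
    have h := (tendsto_rpow_atTop (by linarith : (0 : ℝ) < σ)).comp tendsto_natCast_atTop_atTop
    exact h.eventually_ge_atTop 2
  rw [Filter.eventually_atTop] at hev
  obtain ⟨N, hN⟩ := hev
  refine ⟨max (max D₀ 1) N, le_trans (le_max_left _ _) (le_max_left _ _), ?_⟩
  intro D hD Z hZ i hi
  have hD0 : D₀ ≤ D := le_trans (le_trans (le_max_left _ _) (le_max_left _ _)) hD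
  have hD1 : 1 ≤ D := le_trans (le_trans (le_max_right _ _) (le_max_left _ _)) hD
  have hDσ2 : (2 : ℝ) ≤ (D : ℝ) ^ σ := hN D (le_trans (le_max_right _ _) hD)
  have hDr : (1 : ℝ) ≤ D := by exact_mod_cast hD1
  have hDpos : (0 : ℝ) < D := by linarith
  set T : ℕ := ⌊(D : ℝ) ^ σ⌋₊ with hT
  have hTσ : (T : ℝ) ≤ (D : ℝ) ^ σ := Nat.floor_le (by positivity)
  have hT2 : (D : ℝ) ^ σ / 2 ≤ T := by
    have := Nat.lt_floor_add_one ((D : ℝ) ^ σ)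
    rw [← hT] at this
    linarith
  have hTpos : (0 : ℝ) < T := by linarith
  have hDT : D ≤ T := le_floor_rpow hσ1 D
  have hc4 := AlgPt.c4_nonneg r hs
  have hPD := hPt D hD0
  obtain ⟨t, W, hWmem, hWcard, hWht⟩ := hZB D hD0
  -- exponent bookkeeping
  have e2σ : (D : ℝ) ^ (2 : ℝ) / (D : ℝ) ^ σ = (D : ℝ) ^ (2 - σ) := by
    rw [← Real.rpow_sub hDpos]
  have h1βσ : (D : ℝ) ^ (2 : ℝ) ≤ (D : ℝ) ^ (1 + β - σ) :=
    Real.rpow_le_rpow_of_exponent_le hDr (by linarith)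
  have hσle : (D : ℝ) ^ σ ≤ (D : ℝ) ^ (1 + β - σ) :=
    Real.rpow_le_rpow_of_exponent_le hDr (by linarith)
  have h2σ1 : (1 : ℝ) ≤ (D : ℝ) ^ (2 - σ) := Real.one_le_rpow hDr (by linarith)
  have hD2 : ((D : ℝ)) ^ 2 = (D : ℝ) ^ (2 : ℝ) := by norm_cast
  -- Lemma 11 for the translates and the degrees
  have hdegi : ∀ k : ℤ, (((Z.tauA r hs k).conj).card : ℝ) = ((Z.conj).card : ℝ) := fun k => by
    rw [(Z.tauA r hs k).card_conj, Z.card_conj, Z.deg_tauA r hs k]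
  have hL11 : ∀ k : ℤ, (Z.tauA r hs k).ht ≤ Z.ht + AlgPt.c4 r s * |(k : ℝ)| * (Z.conj).card := by
    intro k
    have := Z.ht_tauA_le r hs k
    rwa [← Z.card_conj] at this
  have hL11' : ∀ k : ℤ, Z.ht ≤ (Z.tauA r hs k).ht + AlgPt.c4 r s * |(k : ℝ)| * (Z.conj).card := by
    intro k
    have h := (Z.tauA r hs k).ht_tauA_le r hs (-k)
    rw [Z.tauA_tauA r hs, neg_add_cancel, Z.tauA_zero r hs, Z.deg_tauA r hs k, ← Z.card_conj] at h
    push_cast at h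
    rwa [abs_neg] at h
  have hi3 : |(i : ℝ)| ≤ 3 * (D : ℝ) ^ σ := by linarith
  -- the dichotomy
  by_cases hfix : ∀ a ∈ Z.conj, a = e010 ∨ a = e001
  · -- `Z` is a fixed point: `deg ≤ 2`, `ht = 0`
    have hcard2 : ((Z.conj).card : ℝ) ≤ 2 := by
      have : Z.conj ⊆ {e010, e001} := fun a ha => by
        rcases hfix a ha with h | h <;> simp [h]
      have h2 := Finset.card_le_card this
      have h3 : ({e010, e001} : Finset PPt).card ≤ 2 := Finset.card_le_two
      exact_mod_cast h2.trans h3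
    have hht0 : Z.ht ≤ 0 := by
      rw [Z.ht_eq_sum_habs]
      refine Finset.sum_nonpos fun a ha => ?_
      rcases hfix a ha with h | h
      · rw [h, habs_e010]
      · rw [h, habs_e001]
    refine ⟨?_, ?_⟩
    · rw [hdegi]; nlinarith
    · calc (Z.tauA r hs i).ht ≤ Z.ht + AlgPt.c4 r s * |(i : ℝ)| * (Z.conj).card := hL11 i
        _ ≤ 0 + AlgPt.c4 r s * (3 * (D : ℝ) ^ σ) * 2 := by
            gcongr
        _ = 6 * AlgPt.c4 r s * (D : ℝ) ^ σ := by ring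
        _ ≤ 6 * AlgPt.c4 r s * (D : ℝ) ^ (1 + β - σ) :=
            mul_le_mul_of_nonneg_left hσle (by positivity)
        _ ≤ (2 * Bz + 7 * AlgPt.c4 r s + 1) * (D : ℝ) ^ (1 + β - σ) := by
            apply mul_le_mul_of_nonneg_right _ (by positivity)
            nlinarith
  · -- generic case: the translates `τᵏ Z`, `0 ≤ k < T`, have distinct classes inside `W`
    push Not at hfix
    obtain ⟨a, ha, ha1, ha2⟩ := hfix
    have hdist : ∀ k ∈ Finset.range T, ∀ l ∈ Finset.range T, k ≠ l →
        (Z.tauA r hs (k : ℤ)).conj ≠ (Z.tauA r hs (l : ℤ)).conj := fun k _ l _ hkl =>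
      conj_tauA_ne hr hs hs1 hs2 Z ha ha1 ha2 (by exact_mod_cast hkl)
    have hWsub : ∀ k ∈ Finset.range T, (Z.tauA r hs (k : ℤ)).conj ⊆ W := by
      intro k hk b hb
      have hk' : k + D < 2 * T := by have := Finset.mem_range.mp hk; omega
      obtain ⟨h1, h2⟩ := vanish_at_conj_tauA hs hPD hZ hk' t (by exact_mod_cast hb)
      exact hWmem b h1 h2
    -- degrees: `T · deg Z ≤ D²`
    have hsum1 := sum_card_conj_le_card (Finset.range T) (fun k => Z.tauA r hs (k : ℤ)) W hdist hWsub
    have hTdeg : (T : ℝ) * (Z.conj).card ≤ (D : ℝ) ^ 2 := by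
      have h1 : ((∑ k ∈ Finset.range T, ((Z.tauA r hs (k : ℤ)).conj).card : ℕ) : ℝ) =
          T * (Z.conj).card := by
        push_cast
        rw [Finset.sum_congr rfl fun (k : ℕ) (_ : k ∈ Finset.range T) => hdegi k, Finset.sum_const,
          Finset.card_range, nsmul_eq_mul]
      have h2 : ((∑ k ∈ Finset.range T, ((Z.tauA r hs (k : ℤ)).conj).card : ℕ) : ℝ) ≤ W.card := by
        exact_mod_cast hsum1
      linarith
    -- heights: `T · ht Z ≤ B_z D^{1+β} + c₄ T D²`
    have hsum2 := sum_sum_conj_le_sum (Finset.range T) (fun k => Z.tauA r hs (k : ℤ)) W hdist hWsub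
      habs fun a _ => habs_nonneg a
    have hsumht : ∑ k ∈ Finset.range T, (Z.tauA r hs (k : ℤ)).ht ≤ Bz * (D : ℝ) ^ (1 + β) := by
      calc ∑ k ∈ Finset.range T, (Z.tauA r hs (k : ℤ)).ht
          = ∑ k ∈ Finset.range T, ∑ b ∈ (Z.tauA r hs (k : ℤ)).conj, habs b :=
            Finset.sum_congr rfl fun k _ => (Z.tauA r hs (k : ℤ)).ht_eq_sum_habs
        _ ≤ ∑ b ∈ W, habs b := hsum2
        _ ≤ Bz * (D : ℝ) ^ (1 + β) := hWht
    have hTht : (T : ℝ) * Z.ht ≤ Bz * (D : ℝ) ^ (1 + β) + AlgPt.c4 r s * T * (D : ℝ) ^ 2 := by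
      have h1 : ∀ k ∈ Finset.range T, Z.ht ≤ (Z.tauA r hs (k : ℤ)).ht +
          AlgPt.c4 r s * T * (Z.conj).card := by
        intro k hk
        have hkT : |((k : ℤ) : ℝ)| ≤ T := by
          have := Finset.mem_range.mp hk
          push_cast
          rw [abs_of_nonneg (Nat.cast_nonneg k)]
          exact_mod_cast this.le
        calc Z.ht ≤ (Z.tauA r hs (k : ℤ)).ht + AlgPt.c4 r s * |((k : ℤ) : ℝ)| * (Z.conj).card :=
              hL11' k
          _ ≤ (Z.tauA r hs (k : ℤ)).ht + AlgPt.c4 r s * T * (Z.conj).card := by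
              gcongr
      have h2 := Finset.sum_le_sum h1
      rw [Finset.sum_const, Finset.card_range, nsmul_eq_mul, Finset.sum_add_distrib,
        Finset.sum_const, Finset.card_range, nsmul_eq_mul] at h2
      have h3 : (T : ℝ) * (AlgPt.c4 r s * T * (Z.conj).card) = AlgPt.c4 r s * T * (T * (Z.conj).card) := by
        ring
      rw [h3] at h2
      have h4 : AlgPt.c4 r s * T * (T * (Z.conj).card) ≤ AlgPt.c4 r s * T * (D : ℝ) ^ 2 :=
        mul_le_mul_of_nonneg_left hTdeg (by positivity)
      linarith
    -- `deg Z ≤ 2 D^{2-σ}` and `ht Z ≤ (2B_z + c₄) D^{1+β-σ}`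
    have hdegZ : ((Z.conj).card : ℝ) ≤ 2 * (D : ℝ) ^ (2 - σ) := by
      rw [← e2σ, ← hD2, mul_div_assoc']
      rw [le_div_iff₀ (by positivity)]
      nlinarith
    have hhtZ : Z.ht ≤ (2 * Bz + AlgPt.c4 r s) * (D : ℝ) ^ (1 + β - σ) := by
      have hβ1 : (D : ℝ) ^ (1 + β) = (D : ℝ) ^ (1 + β - σ) * (D : ℝ) ^ σ := by
        rw [← Real.rpow_add hDpos]; ring_nf
      -- from `T ht ≤ Bz D^{1+β} + c₄ T D²` with `T ≥ D^σ/2`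
      have h1 : (T : ℝ) * Z.ht ≤ (T : ℝ) * ((2 * Bz + AlgPt.c4 r s) * (D : ℝ) ^ (1 + β - σ)) := by
        have h2 : Bz * (D : ℝ) ^ (1 + β) ≤ T * (2 * Bz * (D : ℝ) ^ (1 + β - σ)) := by
          rw [hβ1]
          have : (0 : ℝ) ≤ Bz * (D : ℝ) ^ (1 + β - σ) := by positivity
          nlinarith
        have h3 : AlgPt.c4 r s * T * (D : ℝ) ^ 2 ≤ T * (AlgPt.c4 r s * (D : ℝ) ^ (1 + β - σ)) := by
          rw [hD2]
          have : (0 : ℝ) ≤ AlgPt.c4 r s * T := by positivity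
          nlinarith
        nlinarith
      exact le_of_mul_le_mul_left h1 hTpos
    -- the translates `|i| < 3T`
    refine ⟨by rw [hdegi]; exact hdegZ, ?_⟩
    have hZ0 : 0 ≤ ((Z.conj).card : ℝ) := Nat.cast_nonneg _
    calc (Z.tauA r hs i).ht ≤ Z.ht + AlgPt.c4 r s * |(i : ℝ)| * (Z.conj).card := hL11 i
      _ ≤ (2 * Bz + AlgPt.c4 r s) * (D : ℝ) ^ (1 + β - σ) +
            AlgPt.c4 r s * (3 * (D : ℝ) ^ σ) * (2 * (D : ℝ) ^ (2 - σ)) := by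
          gcongr
      _ = (2 * Bz + AlgPt.c4 r s) * (D : ℝ) ^ (1 + β - σ) + 6 * AlgPt.c4 r s * (D : ℝ) ^ (2 : ℝ) := by
          have : (D : ℝ) ^ σ * (D : ℝ) ^ (2 - σ) = (D : ℝ) ^ (2 : ℝ) := by
            rw [← Real.rpow_add hDpos]; ring_nf
          rw [← this]; ring
      _ ≤ (2 * Bz + AlgPt.c4 r s) * (D : ℝ) ^ (1 + β - σ) +
            6 * AlgPt.c4 r s * (D : ℝ) ^ (1 + β - σ) := by
          gcongr
      _ ≤ (2 * Bz + 7 * AlgPt.c4 r s + 1) * (D : ℝ) ^ (1 + β - σ) := by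
          have hX : (0 : ℝ) ≤ (D : ℝ) ^ (1 + β - σ) := by positivity
          have e : (2 * Bz + 7 * AlgPt.c4 r s + 1) * (D : ℝ) ^ (1 + β - σ) =
              (2 * Bz + AlgPt.c4 r s) * (D : ℝ) ^ (1 + β - σ) +
                6 * AlgPt.c4 r s * (D : ℝ) ^ (1 + β - σ) + (D : ℝ) ^ (1 + β - σ) := by ring
          rw [e]
          linarith

end P14

end NguyenRoy

end Literature.NumberTheory.Transcendental

end
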